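import Literature.MathematicalPhysics.QuantumFieldTheory.Balaban1983to89.Node00.Record13NumericsOfThm1CCMZ
import Literature.MathematicalPhysics.QuantumFieldTheory.Balaban1983to89.Node00.Record13SepCoPLiveSelector

/-!
# NODE 00 (YM-PLAN Track A) — STAGE 13: THE ⁵ SOCKET FOR `Provisos₁₃SepCoP` AT THE ALL-NUMERICS FAMILY WITH THE LETTERS `θ₁₃ᶻ(n, ε₂₉; Efl, logz) = theta13LiveOfNumericsZ …` (Z2)
# — node00-def-K0a's FILE 15a `Record13SepCoPLiveSelector` §2 RE-ISSUED BY TOKEN-PASS AT DEF-1's Z FAMILY; the landed socket is the `(Efl, logz) = (0, 0)` instance (Z2 `theta13LiveOfNumerics_eq_Z`, `rfl`)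

Cell `ym-nodeO-ideate`, DEFINER seat `ym-nodeO-def-1` (gen 28; author lineage of Z1 ∕ Z2 ∕ Z3).  NEW leaf, theorems only (0 `def`); FILE 15a (K0a g7) §1's θ-GENERIC constructor
`Stage13Params.provisos₁₃SepCoP_liveRepin₁₃_of_bgSepCoP` and Z2's letter-generic rows (`hasResidualsOfRecord_theta13OfNumericsZ`, `ztUnity_ ∕ slotsNondegenerate₁₃_…_of_hasResiduals ∕
admissible_theta13LiveOfNumericsZ`) CONSUMED BY NAME, nothing modified.  `--kind proof --supports stmt-QuantumFields-20541` (K0⁷; count-neutral).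
[III] = [Balaban1988Convergent], [IV] = [Balaban1989LargeFieldI], [6] = [Balaban1985RegularSpaces], [15] = [Balaban1985Variational].

WHY.  Every K0 BODY in the tree closes through FILE 15a's socket `exists_k0SepCoP_of_bgSepCoP_theta13LiveOfNumerics`, which is stated for the COUPLING-BLIND family
`theta13LiveOfNumerics … (RzOfRecord) (ZtOfRecord)` (`Efl = logz = 0`).  The K1⁹ ∃-witness must carry print's letters `(E_k, log z_k)` OPEN (director-ym №218, FLAG №9 — DEF-1's Z editions) and
the background radius inside [B11] Thm 1's regime (DEF-1 g27 `K1ZBWitnessBetaRadius`; dag-n24-c g14's adopted repair (b) «K0's box re-stated at `εbg := a₀`»): that witness is a member of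
`theta13LiveOfNumericsZ` (Z3's `theta13OfThm1CCMWZB … εbg … Efl logz` = `theta13LiveOfNumericsZ F N (stage12NumericsOfThm1CCMWB …) …`, Z3 `theta13OfThm1CCMWZB_eq`), for which NO SepCoP socket existed
(Z2 prints the older row `provisos₁₃_theta13LiveOfNumericsZ_of_bg` only).  THIS FILE is FILE 15a §2 at the Z family, ONE TERM EACH over the generic constructor — step L2 of DEF-1 g28's
priced road (`ym-nodeO-ideate/memos/DEF-1-g28/PRICE-K0-body-at-Z3.md`); step L1 = `Record13LettersOfThm1CCMWZB` (the witness-level letters), step L3 = k0-s1's all-torus body at Z3, L4 = the plan's text.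

WHAT THIS FILE PROVES (theorems only).  §1 `provisos₁₃SepCoP_theta13LiveOfNumericsZ_of_bgSepCoP (hM) (hM₁) (hbgSepCoP)` (the v1.4 provisos at every Z member carrying K0b's residuals ⟸ THE
(7)-GUARDED SEPARATED ROW P11 AT THE Co CARRIER ALONE + the two pins) and ★★★ THE ⁵ SOCKET `exists_k0SepCoP_of_bgSepCoP_theta13LiveOfNumericsZ (F) (hn) (hε') (hM) (hM₁) (hbgSepCoP) :
∃ θ : Stage13Params F 2, θ.Provisos₁₃SepCoP F 2 ∧ (θ.ZtUnity F 2 ∧ θ.SlotsNondegenerate₁₃ F 2) ∧ θ.Admissible F 2`; at `(Efl, logz) := (0, 0)` these ARE FILE 15a's two theorems (Z2 bridge `theta13LiveOfNumerics_eq_Z`, `rfl`).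

HONEST FRAMING.  Bookkeeping (instantiation by name of a θ-generic constructor); the guarded row is a DISPLAYED HYPOTHESIS; nothing of Bałaban asserted; NOT a discharge; no letter value
pinned; K0⁷ stmt-QuantumFields-20541 (V21-G 1d9e17422df218f7, 0∕2) texts untouched and NOT closed; K1⁹ 27364 ∕ K3⁸ 27366 OPEN; counts unmoved (typed 28∕28 · discharged 8∕28); one finite 𝕋⁴
programme at fixed ε — NOT continuum ∕ ℝ⁴ ∕ OS; R4 = the conditional finite-𝕋⁴ rung `BalabanLadder.UV` only; the Yang–Mills mass gap (Clay) is NOT proved by any of this.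
No `sorry`, `axiom`, `def`, `instance`, `notation`.
-/

noncomputable section

open MeasureTheory
open scoped Matrix.Norms.L2Operator

namespace Literature.MathematicalPhysics.QuantumFieldTheory.Balaban1983to89.Node00

open T4Continuum B14.Eq218Concrete B15DeterminingSets B15RopTotal FlowStep FlowStepRuns

/-! ## §1. At the all-numerics family WITH THE LETTERS `θ₁₃ᶻ(n, ε₂₉; Efl, logz)`: `Provisos₁₃SepCoP` from the guarded row alone, and ★★★ THE ⁵ SOCKET -/

section AllNumericsSepCoPZ

variable (F : T4Family) (N : ℕ) [NeZero N] (n : Stage12Numerics) (ε₂₉ : ℝ) (Efl logz : B12.RunParams → ℕ → ℝ)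

/-- **★ `Provisos₁₃SepCoP` AT EVERY MEMBER OF THE ALL-NUMERICS FAMILY CARRYING K0b's RESIDUALS, FROM THE (7)-GUARDED SEPARATED ROW AT THE Co CARRIER THERE ALONE** (plus the two pins).
[cite: Balaban1988Convergent, (2.18) p.257, (2.28) p.259, (3.16) p.268, (3.22) p.269; Balaban1985RegularSpaces, (1.3)–(1.9) p.77; Balaban1985Variational, (6)–(7) p.278; Balaban1989LargeFieldI, (0.3)–(0.4) p.176 (bookkeeping)] -/
theorem provisos₁₃SepCoP_theta13LiveOfNumericsZ_of_bgSepCoP (hM : ∃ a : ℕ, n.τ9.M = F.L ^ a) (hM₁ : n.ν.M₁ ∣ n.τ9.M)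
    (hbgSepCoP : ∀ (p : B12.RunParams) (m : ℕ), m ≤ p.K → Step.InInterval (theta13LiveOfNumericsZ F N n ε₂₉ (zeta316OfRecord F N n.ν n.τ9.M n.A₁) (RzOfRecord F N) (ZtOfRecord F N) Efl logz).γ m (gOfRecord₁₃ F N (theta13LiveOfNumericsZ F N n ε₂₉ (zeta316OfRecord F N n.ν n.τ9.M n.A₁) (RzOfRecord F N) (ZtOfRecord F N) Efl logz) p) → PartCompat₁₃ F N (theta13LiveOfNumericsZ F N n ε₂₉ (zeta316OfRecord F N n.ν n.τ9.M n.A₁) (RzOfRecord F N) (ZtOfRecord F N) Efl logz) p m →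
      ∀ s : SeqOfRecord F (theta13LiveOfNumericsZ F N n ε₂₉ (zeta316OfRecord F N n.ν n.τ9.M n.A₁) (RzOfRecord F N) (ZtOfRecord F N) Efl logz).ν (theta13LiveOfNumericsZ F N n ε₂₉ (zeta316OfRecord F N n.ν n.τ9.M n.A₁) (RzOfRecord F N) (ZtOfRecord F N) Efl logz).τ9.M (gOfRecord₁₃ F N (theta13LiveOfNumericsZ F N n ε₂₉ (zeta316OfRecord F N n.ν n.τ9.M n.A₁) (RzOfRecord F N) (ZtOfRecord F N) Efl logz) p) p.K m, Sect2.SeqSeparated (theta13LiveOfNumericsZ F N n ε₂₉ (zeta316OfRecord F N n.ν n.τ9.M n.A₁) (RzOfRecord F N) (ZtOfRecord F N) Efl logz).ν.M₁ s →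
      ∀ W : MSField (F.P p.K) (SU N), W ∈ suppOfRecord₁₃P F N (theta13LiveOfNumericsZ F N n ε₂₉ (zeta316OfRecord F N n.ν n.τ9.M n.A₁) (RzOfRecord F N) (ZtOfRecord F N) Efl logz) p m s →
      Sect2.DataSmall7PTop (avOfRecord F N p.K) s.Ω (suppDomOfRecord F (theta13LiveOfNumericsZ F N n ε₂₉ (zeta316OfRecord F N n.ν n.τ9.M n.A₁) (RzOfRecord F N) (ZtOfRecord F N) Efl logz).ν p.K s.Ω) m (fun j => (theta13LiveOfNumericsZ F N n ε₂₉ (zeta316OfRecord F N n.ν n.τ9.M n.A₁) (RzOfRecord F N) (ZtOfRecord F N) Efl logz).s2.cR * epsOfRecord (theta13LiveOfNumericsZ F N n ε₂₉ (zeta316OfRecord F N n.ν n.τ9.M n.A₁) (RzOfRecord F N) (ZtOfRecord F N) Efl logz).ν (gOfRecord₁₃ F N (theta13LiveOfNumericsZ F N n ε₂₉ (zeta316OfRecord F N n.ν n.τ9.M n.A₁) (RzOfRecord F N) (ZtOfRecord F N) Efl logz) p) j) W →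
      ∀ j, 1 ≤ j → j ≤ m → ∀ X : (Sect2.domSys (F.P p.K) (theta13LiveOfNumericsZ F N n ε₂₉ (zeta316OfRecord F N n.ν n.τ9.M n.A₁) (RzOfRecord F N) (ZtOfRecord F N) Efl logz).τ9.M j).Dom,
      (Sect2.domSites (F.P p.K) (theta13LiveOfNumericsZ F N n ε₂₉ (zeta316OfRecord F N n.ν n.τ9.M n.A₁) (RzOfRecord F N) (ZtOfRecord F N) Efl logz).τ9.M j X ⊆ s.Λ j →
        Sect2.ofBackgroundC (settingOfRecord₁₃ F N (theta13LiveOfNumericsZ F N n ε₂₉ (zeta316OfRecord F N n.ν n.τ9.M n.A₁) (RzOfRecord F N) (ZtOfRecord F N) Efl logz) p).ι (UbgOfRecord₁₃CoP F N (theta13LiveOfNumericsZ F N n ε₂₉ (zeta316OfRecord F N n.ν n.τ9.M n.A₁) (RzOfRecord F N) (ZtOfRecord F N) Efl logz) p m s W) ∈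
          Sect2.spaceI (settingOfRecord₁₃ F N (theta13LiveOfNumericsZ F N n ε₂₉ (zeta316OfRecord F N n.ν n.τ9.M n.A₁) (RzOfRecord F N) (ZtOfRecord F N) Efl logz) p) ((theta13LiveOfNumericsZ F N n ε₂₉ (zeta316OfRecord F N n.ν n.τ9.M n.A₁) (RzOfRecord F N) (ZtOfRecord F N) Efl logz).Rz p.K) (theta13LiveOfNumericsZ F N n ε₂₉ (zeta316OfRecord F N n.ν n.τ9.M n.A₁) (RzOfRecord F N) (ZtOfRecord F N) Efl logz).τ9.M j (Sect2.domSites (F.P p.K) (theta13LiveOfNumericsZ F N n ε₂₉ (zeta316OfRecord F N n.ν n.τ9.M n.A₁) (RzOfRecord F N) (ZtOfRecord F N) Efl logz).τ9.M j X)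
            ((settingOfRecord₁₃ F N (theta13LiveOfNumericsZ F N n ε₂₉ (zeta316OfRecord F N n.ν n.τ9.M n.A₁) (RzOfRecord F N) (ZtOfRecord F N) Efl logz) p).lf.alpha0 ((settingOfRecord₁₃ F N (theta13LiveOfNumericsZ F N n ε₂₉ (zeta316OfRecord F N n.ν n.τ9.M n.A₁) (RzOfRecord F N) (ZtOfRecord F N) Efl logz) p).flow.g j)) ((settingOfRecord₁₃ F N (theta13LiveOfNumericsZ F N n ε₂₉ (zeta316OfRecord F N n.ν n.τ9.M n.A₁) (RzOfRecord F N) (ZtOfRecord F N) Efl logz) p).lf.alpha1 ((settingOfRecord₁₃ F N (theta13LiveOfNumericsZ F N n ε₂₉ (zeta316OfRecord F N n.ν n.τ9.M n.A₁) (RzOfRecord F N) (ZtOfRecord F N) Efl logz) p).flow.g j))) ∧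
      (Sect2.admB (F.P p.K) (theta13LiveOfNumericsZ F N n ε₂₉ (zeta316OfRecord F N n.ν n.τ9.M n.A₁) (RzOfRecord F N) (ZtOfRecord F N) Efl logz).ν (theta13LiveOfNumericsZ F N n ε₂₉ (zeta316OfRecord F N n.ν n.τ9.M n.A₁) (RzOfRecord F N) (ZtOfRecord F N) Efl logz).τ9.M (gOfRecord₁₃ F N (theta13LiveOfNumericsZ F N n ε₂₉ (zeta316OfRecord F N n.ν n.τ9.M n.A₁) (RzOfRecord F N) (ZtOfRecord F N) Efl logz) p) s.Ω s.Λ j (Sect2.domSites (F.P p.K) (theta13LiveOfNumericsZ F N n ε₂₉ (zeta316OfRecord F N n.ν n.τ9.M n.A₁) (RzOfRecord F N) (ZtOfRecord F N) Efl logz).τ9.M j X) = true →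
        Sect2.ofBackgroundC (settingOfRecord₁₃ F N (theta13LiveOfNumericsZ F N n ε₂₉ (zeta316OfRecord F N n.ν n.τ9.M n.A₁) (RzOfRecord F N) (ZtOfRecord F N) Efl logz) p).ι (UbgOfRecord₁₃CoP F N (theta13LiveOfNumericsZ F N n ε₂₉ (zeta316OfRecord F N n.ν n.τ9.M n.A₁) (RzOfRecord F N) (ZtOfRecord F N) Efl logz) p m s W) ∈
          Sect2.spaceMS (settingOfRecord₁₃ F N (theta13LiveOfNumericsZ F N n ε₂₉ (zeta316OfRecord F N n.ν n.τ9.M n.A₁) (RzOfRecord F N) (ZtOfRecord F N) Efl logz) p) ((theta13LiveOfNumericsZ F N n ε₂₉ (zeta316OfRecord F N n.ν n.τ9.M n.A₁) (RzOfRecord F N) (ZtOfRecord F N) Efl logz).Rz p.K) (theta13LiveOfNumericsZ F N n ε₂₉ (zeta316OfRecord F N n.ν n.τ9.M n.A₁) (RzOfRecord F N) (ZtOfRecord F N) Efl logz).τ9.M j (Sect2.domSites (F.P p.K) (theta13LiveOfNumericsZ F N n ε₂₉ (zeta316OfRecord F N n.ν n.τ9.M n.A₁) (RzOfRecord F N)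 (ZtOfRecord F N) Efl logz).τ9.M j X) s.Ω)) :
    (theta13LiveOfNumericsZ F N n ε₂₉ (zeta316OfRecord F N n.ν n.τ9.M n.A₁) (RzOfRecord F N) (ZtOfRecord F N) Efl logz).Provisos₁₃SepCoP F N :=
  (theta13OfNumericsZ F N n ε₂₉ _ _ _ Efl logz).provisos₁₃SepCoP_liveRepin₁₃_of_bgSepCoP (hasResidualsOfRecord_theta13OfNumericsZ F N n ε₂₉ Efl logz) hM hM₁ hbgSepCoP

/-- **★★★ THE ⁵ SOCKET — THE REV-20 K0 BODY FOR `F` AT `N = 2` AT ANY NUMERICS from `n.Pos`, `0 < ε₂₉`, the two pins and THE (7)-GUARDED SEPARATED ROW P11 AT THE Co CARRIER there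
ALONE** (row Z by K0b's residual laws, row P12 hypothesis-free, row G by `admissible_theta13LiveOfNumerics`).  A REDUCTION — NOT a discharge. [cite: Balaban1988Convergent, Thm 1 p.262, (2.7) p.255, (2.12) p.256, (2.28) p.259, (3.16)–(3.22) pp.268–269; Balaban1985RegularSpaces, (1.3)–(1.9) p.77; Balaban1985Variational, (6)–(7) p.278; Balaban1989LargeFieldI, (0.3)–(0.4) p.176 (bookkeeping)] -/
theorem exists_k0SepCoP_of_bgSepCoP_theta13LiveOfNumericsZ (F : T4Family) {n : Stage12Numerics} {ε₂₉ : ℝ} {Efl logz : B12.RunParams → ℕ → ℝ} (hn : n.Pos) (hε' : 0 < ε₂₉) (hM : ∃ a : ℕ, n.τ9.M = F.L ^ a) (hM₁ : n.ν.M₁ ∣ n.τ9.M)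
    (hbgSepCoP : ∀ (p : B12.RunParams) (m : ℕ), m ≤ p.K → Step.InInterval (theta13LiveOfNumericsZ F 2 n ε₂₉ (zeta316OfRecord F 2 n.ν n.τ9.M n.A₁) (RzOfRecord F 2) (ZtOfRecord F 2) Efl logz).γ m (gOfRecord₁₃ F 2 (theta13LiveOfNumericsZ F 2 n ε₂₉ (zeta316OfRecord F 2 n.ν n.τ9.M n.A₁) (RzOfRecord F 2) (ZtOfRecord F 2) Efl logz) p) → PartCompat₁₃ F 2 (theta13LiveOfNumericsZ F 2 n ε₂₉ (zeta316OfRecord F 2 n.ν n.τ9.M n.A₁) (RzOfRecord F 2) (ZtOfRecord F 2) Efl logz) p m →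
      ∀ s : SeqOfRecord F (theta13LiveOfNumericsZ F 2 n ε₂₉ (zeta316OfRecord F 2 n.ν n.τ9.M n.A₁) (RzOfRecord F 2) (ZtOfRecord F 2) Efl logz).ν (theta13LiveOfNumericsZ F 2 n ε₂₉ (zeta316OfRecord F 2 n.ν n.τ9.M n.A₁) (RzOfRecord F 2) (ZtOfRecord F 2) Efl logz).τ9.M (gOfRecord₁₃ F 2 (theta13LiveOfNumericsZ F 2 n ε₂₉ (zeta316OfRecord F 2 n.ν n.τ9.M n.A₁) (RzOfRecord F 2) (ZtOfRecord F 2) Efl logz) p) p.K m, Sect2.SeqSeparated (theta13LiveOfNumericsZ F 2 n ε₂₉ (zeta316OfRecord F 2 n.ν n.τ9.M n.A₁) (RzOfRecord F 2) (ZtOfRecord F 2) Efl logz).ν.M₁ s →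
      ∀ W : MSField (F.P p.K) (SU 2), W ∈ suppOfRecord₁₃P F 2 (theta13LiveOfNumericsZ F 2 n ε₂₉ (zeta316OfRecord F 2 n.ν n.τ9.M n.A₁) (RzOfRecord F 2) (ZtOfRecord F 2) Efl logz) p m s →
      Sect2.DataSmall7PTop (avOfRecord F 2 p.K) s.Ω (suppDomOfRecord F (theta13LiveOfNumericsZ F 2 n ε₂₉ (zeta316OfRecord F 2 n.ν n.τ9.M n.A₁) (RzOfRecord F 2) (ZtOfRecord F 2) Efl logz).ν p.K s.Ω) m (fun j => (theta13LiveOfNumericsZ F 2 n ε₂₉ (zeta316OfRecord F 2 n.ν n.τ9.M n.A₁) (RzOfRecord F 2) (ZtOfRecord F 2) Efl logz).s2.cR * epsOfRecord (theta13LiveOfNumericsZ F 2 n ε₂₉ (zeta316OfRecord F 2 n.ν n.τ9.M n.A₁) (RzOfRecord F 2) (ZtOfRecord F 2) Efl logz).ν (gOfRecord₁₃ F 2 (theta13LiveOfNumericsZ F 2 n ε₂₉ (zeta316OfRecord F 2 n.ν n.τ9.M n.A₁) (RzOfRecord F 2) (ZtOfRecord F 2) Efl logz) p) j) W →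
      ∀ j, 1 ≤ j → j ≤ m → ∀ X : (Sect2.domSys (F.P p.K) (theta13LiveOfNumericsZ F 2 n ε₂₉ (zeta316OfRecord F 2 n.ν n.τ9.M n.A₁) (RzOfRecord F 2) (ZtOfRecord F 2) Efl logz).τ9.M j).Dom,
      (Sect2.domSites (F.P p.K) (theta13LiveOfNumericsZ F 2 n ε₂₉ (zeta316OfRecord F 2 n.ν n.τ9.M n.A₁) (RzOfRecord F 2) (ZtOfRecord F 2) Efl logz).τ9.M j X ⊆ s.Λ j →
        Sect2.ofBackgroundC (settingOfRecord₁₃ F 2 (theta13LiveOfNumericsZ F 2 n ε₂₉ (zeta316OfRecord F 2 n.ν n.τ9.M n.A₁) (RzOfRecord F 2) (ZtOfRecord F 2) Efl logz) p).ι (UbgOfRecord₁₃CoP F 2 (theta13LiveOfNumericsZ F 2 n ε₂₉ (zeta316OfRecord F 2 n.ν n.τ9.M n.A₁) (RzOfRecord F 2) (ZtOfRecord F 2) Efl logz) p m s W) ∈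
          Sect2.spaceI (settingOfRecord₁₃ F 2 (theta13LiveOfNumericsZ F 2 n ε₂₉ (zeta316OfRecord F 2 n.ν n.τ9.M n.A₁) (RzOfRecord F 2) (ZtOfRecord F 2) Efl logz) p) ((theta13LiveOfNumericsZ F 2 n ε₂₉ (zeta316OfRecord F 2 n.ν n.τ9.M n.A₁) (RzOfRecord F 2) (ZtOfRecord F 2) Efl logz).Rz p.K) (theta13LiveOfNumericsZ F 2 n ε₂₉ (zeta316OfRecord F 2 n.ν n.τ9.M n.A₁) (RzOfRecord F 2) (ZtOfRecord F 2) Efl logz).τ9.M j (Sect2.domSites (F.P p.K) (theta13LiveOfNumericsZ F 2 n ε₂₉ (zeta316OfRecord F 2 n.ν n.τ9.M n.A₁) (RzOfRecord F 2) (ZtOfRecord F 2) Efl logz).τ9.M j X)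
            ((settingOfRecord₁₃ F 2 (theta13LiveOfNumericsZ F 2 n ε₂₉ (zeta316OfRecord F 2 n.ν n.τ9.M n.A₁) (RzOfRecord F 2) (ZtOfRecord F 2) Efl logz) p).lf.alpha0 ((settingOfRecord₁₃ F 2 (theta13LiveOfNumericsZ F 2 n ε₂₉ (zeta316OfRecord F 2 n.ν n.τ9.M n.A₁) (RzOfRecord F 2) (ZtOfRecord F 2) Efl logz) p).flow.g j)) ((settingOfRecord₁₃ F 2 (theta13LiveOfNumericsZ F 2 n ε₂₉ (zeta316OfRecord F 2 n.ν n.τ9.M n.A₁) (RzOfRecord F 2) (ZtOfRecord F 2) Efl logz) p).lf.alpha1 ((settingOfRecord₁₃ F 2 (theta13LiveOfNumericsZ F 2 n ε₂₉ (zeta316OfRecord F 2 n.ν n.τ9.M n.A₁) (RzOfRecord F 2) (ZtOfRecord F 2) Efl logz) p).flow.g j))) ∧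
      (Sect2.admB (F.P p.K) (theta13LiveOfNumericsZ F 2 n ε₂₉ (zeta316OfRecord F 2 n.ν n.τ9.M n.A₁) (RzOfRecord F 2) (ZtOfRecord F 2) Efl logz).ν (theta13LiveOfNumericsZ F 2 n ε₂₉ (zeta316OfRecord F 2 n.ν n.τ9.M n.A₁) (RzOfRecord F 2) (ZtOfRecord F 2) Efl logz).τ9.M (gOfRecord₁₃ F 2 (theta13LiveOfNumericsZ F 2 n ε₂₉ (zeta316OfRecord F 2 n.ν n.τ9.M n.A₁) (RzOfRecord F 2) (ZtOfRecord F 2) Efl logz) p) s.Ω s.Λ j (Sect2.domSites (F.P p.K) (theta13LiveOfNumericsZ F 2 n ε₂₉ (zeta316OfRecord F 2 n.ν n.τ9.M n.A₁) (RzOfRecord F 2) (ZtOfRecord F 2) Efl logz).τ9.M j X) = true →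
        Sect2.ofBackgroundC (settingOfRecord₁₃ F 2 (theta13LiveOfNumericsZ F 2 n ε₂₉ (zeta316OfRecord F 2 n.ν n.τ9.M n.A₁) (RzOfRecord F 2) (ZtOfRecord F 2) Efl logz) p).ι (UbgOfRecord₁₃CoP F 2 (theta13LiveOfNumericsZ F 2 n ε₂₉ (zeta316OfRecord F 2 n.ν n.τ9.M n.A₁) (RzOfRecord F 2) (ZtOfRecord F 2) Efl logz) p m s W) ∈
          Sect2.spaceMS (settingOfRecord₁₃ F 2 (theta13LiveOfNumericsZ F 2 n ε₂₉ (zeta316OfRecord F 2 n.ν n.τ9.M n.A₁) (RzOfRecord F 2) (ZtOfRecord F 2) Efl logz) p) ((theta13LiveOfNumericsZ F 2 n ε₂₉ (zeta316OfRecord F 2 n.ν n.τ9.M n.A₁) (RzOfRecord F 2) (ZtOfRecord F 2) Efl logz).Rz p.K) (theta13LiveOfNumericsZ F 2 n ε₂₉ (zeta316OfRecord F 2 n.ν n.τ9.M n.A₁) (RzOfRecord F 2) (ZtOfRecord F 2) Efl logz).τ9.M j (Sect2.domSites (F.P p.K) (theta13LiveOfNumericsZ F 2 n ε₂₉ (zeta316OfRecord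 F 2 n.ν n.τ9.M n.A₁) (RzOfRecord F 2) (ZtOfRecord F 2) Efl logz).τ9.M j X) s.Ω)) :
    ∃ θ : Stage13Params F 2, θ.Provisos₁₃SepCoP F 2 ∧ (θ.ZtUnity F 2 ∧ θ.SlotsNondegenerate₁₃ F 2) ∧ θ.Admissible F 2 :=
  ⟨_, provisos₁₃SepCoP_theta13LiveOfNumericsZ_of_bgSepCoP F 2 n ε₂₉ Efl logz hM hM₁ hbgSepCoP,
    ⟨ztUnity_theta13LiveOfNumericsZ F 2 n ε₂₉ Efl logz, slotsNondegenerate₁₃_theta13LiveOfNumericsZ_of_hasResiduals F 2 n ε₂₉ Efl logz⟩,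
    admissible_theta13LiveOfNumericsZ F 2 _ _ _ Efl logz hn hε'⟩

end AllNumericsSepCoPZ

end Literature.MathematicalPhysics.QuantumFieldTheory.Balaban1983to89.Node00

end
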